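import Summits.HubbardSuperconductivity.HubbardSuperconductivity.Theorems.BalabanIRBirComplexStableXYRStubFatGaussianDomination
import HarnessLib

/-!
# Crux `BirComplexStableXYR`, line `fat-gaussian-defect-calculus`: stub S3 `stub_subGaussianMargin`

Registered stub (lead a4, skeleton `Cruxes/BirComplexStableXYR/Lines/fat_gaussian_defect_calculus.lean`):
**on windows of oscillation `≤ π` the real part of `F = genF c` dominates the fixed multiple
`(2c₀r³/(π²B))` of the real Hessian form `Q(φ) = −Re Σ_n c_n (n·φ)²`**, hence
`‖e^{−KF(φ)}‖ ≤ exp(−(2c₀r³/(π²B))·K·Q(φ))`.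

Proof (elementary; escalated route prover, seat 0):
* coercivity (C): `Re F ≥ c₀ ΣΣ(1 − cos(φ_w − φ_w'))`, and Jordan (`FatGaussian.two_mul_sq_div_pi_sq_le_one_sub_cos`,
  valid as `|φ_w − φ_w'| ≤ π`): `ΣΣ(1 − cos) ≥ (2/π²)·T`, `T := ΣΣ(φ_w − φ_w')²`;
* `r³·Q(φ) ≤ B·T`: for a zero-sum frequency `n`, `n·φ = n·ψ` with `ψ = φ − mean φ`, Cauchy–Schwarz
  `(n·ψ)² ≤ ‖n‖₂² Σψ²`, the variance identity `2r³Σψ² = T`, `‖n‖₂² ≤ ‖n‖₁² ≤ 2e^{‖n‖₁}`, and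
  `Σ‖c_n‖e^{‖n‖₁} = normA c ≤ B`.
No definitions; sorry-free.
-/

set_option linter.dupNamespace false -- summit = problem name (single-conjunct summit), D-0017

namespace Summit.HubbardSuperconductivity.HubbardSuperconductivity.Theorems.FatGaussian

open scoped BigOperators ComplexConjugate
open Finset Summit.HubbardSuperconductivity.BirComplexStableXYNegative

/-- `Σ a_w² ≤ (Σ a_w)²` for nonnegative `a`. [folklore] -/
theorem sum_sq_le_sq_sum {α : Type*} (s : Finset α) {a : α → ℝ} (ha : ∀ i ∈ s, 0 ≤ a i) :
    ∑ i ∈ s, a i ^ 2 ≤ (∑ i ∈ s, a i) ^ 2 := by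
  rw [sq, Finset.sum_mul]
  refine Finset.sum_le_sum fun i hi => ?_
  rw [sq]
  exact mul_le_mul_of_nonneg_left (Finset.single_le_sum ha hi) (ha i hi)

/-- For a zero-sum integer frequency `n` the linear form only sees fluctuations:
`Σ_w n_w φ_w = Σ_w n_w (φ_w − m)`. [folklore] -/
theorem sum_mul_eq_sum_mul_sub {r : ℕ} (n : Freq r) (hn : ∑ w, n w = 0) (φ : W r → ℝ) (m : ℝ) :
    ∑ w, (n w : ℝ) * φ w = ∑ w, (n w : ℝ) * (φ w - m) := by
  have h0 : ∑ w, (n w : ℝ) = 0 := by exact_mod_cast hn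
  simp only [mul_sub, Finset.sum_sub_distrib, ← Finset.sum_mul, h0, zero_mul, sub_zero]

/-- The variance identity: `ΣΣ (ψ_w − ψ_w')² = 2·|W|·Σ ψ_w²` when `Σ ψ = 0`. [folklore] -/
theorem sum_sum_sub_sq_eq {α : Type*} [Fintype α] (ψ : α → ℝ) (h0 : ∑ w, ψ w = 0) :
    ∑ w, ∑ w', (ψ w - ψ w') ^ 2 = 2 * (Fintype.card α : ℝ) * ∑ w, ψ w ^ 2 := by
  have hexp : ∀ w w' : α, (ψ w - ψ w') ^ 2 = ψ w ^ 2 + ψ w' ^ 2 - 2 * ψ w * ψ w' := fun w w' => by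
    ring
  simp only [hexp, Finset.sum_add_distrib, Finset.sum_sub_distrib, Finset.sum_const,
    Finset.card_univ, nsmul_eq_mul, ← Finset.mul_sum, ← Finset.sum_mul]
  rw [h0]
  ring

/-- **Stub S3 `stub_subGaussianMargin` (registered signature, verbatim).** [folklore] -/
theorem stub_subGaussianMargin :
    ∀ (r : ℕ) (B c₀ K : ℝ) (c : Table r), 0 < B → 0 ≤ c₀ → 0 ≤ K → (∀ n ∈ c.support, ∑ w, n w = 0) → normA c ≤ B → (∀ φ : W r → ℝ, c₀ * ∑ w, ∑ w', (1 - Real.cos (φ w - φ w')) ≤ (genF c φ).re) → ∀ φ : W r → ℝ, (∀ w w' : W r, |φ w - φ w'| ≤ Real.pi) → ‖Complex.exp (-((K : ℂ) * genF c φ))‖ ≤ Real.exp (-(2 * c₀ * (r : ℝ) ^ 3 / (Real.pi ^ 2 * B)) * K * (-c.sum (fun n a => a * (((∑ w, (n w : ℝ) * φ w) ^ 2 : ℝ) : ℂ))).re) := by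
  intro r B c₀ K c hB hc₀ hK hzs hA hC φ hosc
  rw [Complex.norm_exp, Real.exp_le_exp, Complex.neg_re, Complex.re_ofReal_mul]
  have hπ : 0 < Real.pi ^ 2 := by positivity
  -- notation
  set x : Freq r → ℝ := fun n => ∑ w, (n w : ℝ) * φ w with hx
  set T : ℝ := ∑ w, ∑ w', (φ w - φ w') ^ 2 with hT
  set S : ℝ := ∑ w, ∑ w', (1 - Real.cos (φ w - φ w')) with hS
  -- the Hessian form as a real sum over the support
  have hQ : (-c.sum (fun n a => a * (((∑ w, (n w : ℝ) * φ w) ^ 2 : ℝ) : ℂ))).re =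
      ∑ n ∈ c.support, -((c n).re * x n ^ 2) := by
    rw [Complex.neg_re, Finsupp.sum, Complex.re_sum, ← Finset.sum_neg_distrib]
    refine Finset.sum_congr rfl fun n _ => ?_
    rw [Complex.re_mul_ofReal]
  rw [hQ]
  -- Step B: Jordan, termwise
  have hJ : 2 / Real.pi ^ 2 * T ≤ S := by
    rw [hT, hS, Finset.mul_sum]
    refine Finset.sum_le_sum fun w _ => ?_
    rw [Finset.mul_sum]
    refine Finset.sum_le_sum fun w' _ => ?_
    have := two_mul_sq_div_pi_sq_le_one_sub_cos (hosc w w')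
    calc 2 / Real.pi ^ 2 * (φ w - φ w') ^ 2 = 2 * (φ w - φ w') ^ 2 / Real.pi ^ 2 := by ring
      _ ≤ 1 - Real.cos (φ w - φ w') := this
  have hT0 : 0 ≤ T := by
    rw [hT]; exact Finset.sum_nonneg fun w _ => Finset.sum_nonneg fun w' _ => sq_nonneg _
  -- Step A: `r³ · Q(φ) ≤ B · T`
  have hA' : (r : ℝ) ^ 3 * ∑ n ∈ c.support, -((c n).re * x n ^ 2) ≤ B * T := by
    rcases Nat.eq_zero_or_pos r with hr | hr
    · -- empty window: everything vanishes
      subst hr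
      simp only [pow_succ, pow_zero, CharP.cast_eq_zero, mul_zero, zero_mul]
      exact mul_nonneg hB.le hT0
    · -- the mean and the fluctuation
      set N : ℝ := (Fintype.card (W r) : ℝ) with hN
      have hNr : N = (r : ℝ) ^ 3 := by
        rw [hN]
        simp only [W, Fintype.card_prod, Fintype.card_fin]
        push_cast
        ring
      have hN0 : 0 < N := by rw [hNr]; positivity
      set m : ℝ := (∑ w, φ w) / N with hm
      set ψ : W r → ℝ := fun w => φ w - m with hψ
      have hψ0 : ∑ w, ψ w = 0 := by
        simp only [hψ, Finset.sum_sub_distrib, Finset.sum_const, Finset.card_univ, nsmul_eq_mul]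
        rw [← hN, hm, mul_div_cancel₀ _ hN0.ne', sub_self]
      have hTψ : T = 2 * N * ∑ w, ψ w ^ 2 := by
        rw [hT, hN, ← sum_sum_sub_sq_eq ψ hψ0]
        refine Finset.sum_congr rfl fun w _ => Finset.sum_congr rfl fun w' _ => ?_
        simp only [hψ]
        ring
      -- termwise bound `N · (−Re c_n · x_n²) ≤ ‖c_n‖ e^{‖n‖₁} · T`
      have hterm : ∀ n ∈ c.support,
          N * -((c n).re * x n ^ 2) ≤ ‖c n‖ * Real.exp (∑ w, |(n w : ℝ)|) * T := by
        intro n hn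
        have hxψ : x n = ∑ w, (n w : ℝ) * ψ w := sum_mul_eq_sum_mul_sub n (hzs n hn) φ m
        have hCS : x n ^ 2 ≤ (∑ w, (n w : ℝ) ^ 2) * ∑ w, ψ w ^ 2 := by
          rw [hxψ]; exact Finset.sum_mul_sq_le_sq_mul_sq _ _ _
        have hn2 : ∑ w, (n w : ℝ) ^ 2 ≤ 2 * Real.exp (∑ w, |(n w : ℝ)|) := by
          calc ∑ w, (n w : ℝ) ^ 2 = ∑ w, |(n w : ℝ)| ^ 2 := by simp [sq_abs]
            _ ≤ (∑ w, |(n w : ℝ)|) ^ 2 := sum_sq_le_sq_sum _ fun w _ => abs_nonneg _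
            _ ≤ 2 * Real.exp (∑ w, |(n w : ℝ)|) := by
                -- `x² ≤ 2eˣ` for `x ≥ 0` (tree: `Literature.Analysis.FluidPDE.sq_le_two_mul_exp`)
                have h0 : 0 ≤ ∑ w, |(n w : ℝ)| := Finset.sum_nonneg fun w _ => abs_nonneg _
                have h := Real.quadratic_le_exp_of_nonneg h0
                nlinarith [Real.exp_pos (∑ w, |(n w : ℝ)|)]
        have hre : -((c n).re * x n ^ 2) ≤ ‖c n‖ * x n ^ 2 := by
          have h1 : -(c n).re ≤ ‖c n‖ := by
            have := Complex.abs_re_le_norm (c n)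
            have := neg_abs_le (c n).re
            linarith
          nlinarith [sq_nonneg (x n)]
        have hψ2 : 0 ≤ ∑ w, ψ w ^ 2 := Finset.sum_nonneg fun w _ => sq_nonneg _
        calc N * -((c n).re * x n ^ 2) ≤ N * (‖c n‖ * x n ^ 2) :=
              mul_le_mul_of_nonneg_left hre hN0.le
          _ ≤ N * (‖c n‖ * ((∑ w, (n w : ℝ) ^ 2) * ∑ w, ψ w ^ 2)) := by
              gcongr
          _ ≤ N * (‖c n‖ * ((2 * Real.exp (∑ w, |(n w : ℝ)|)) * ∑ w, ψ w ^ 2)) := by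
              gcongr
          _ = ‖c n‖ * Real.exp (∑ w, |(n w : ℝ)|) * T := by rw [hTψ]; ring
      calc (r : ℝ) ^ 3 * ∑ n ∈ c.support, -((c n).re * x n ^ 2)
          = ∑ n ∈ c.support, N * -((c n).re * x n ^ 2) := by rw [← hNr, Finset.mul_sum]
        _ ≤ ∑ n ∈ c.support, ‖c n‖ * Real.exp (∑ w, |(n w : ℝ)|) * T := Finset.sum_le_sum hterm
        _ = normA c * T := by rw [normA, Finsupp.sum, Finset.sum_mul]
        _ ≤ B * T := mul_le_mul_of_nonneg_right hA hT0
  -- combine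
  have hcoef : 0 ≤ 2 * c₀ * K / (Real.pi ^ 2 * B) := by positivity
  have h3 : 2 * c₀ * (r : ℝ) ^ 3 / (Real.pi ^ 2 * B) * K * ∑ n ∈ c.support, -((c n).re * x n ^ 2) ≤
      K * (genF c φ).re :=
    calc 2 * c₀ * (r : ℝ) ^ 3 / (Real.pi ^ 2 * B) * K * ∑ n ∈ c.support, -((c n).re * x n ^ 2)
        = 2 * c₀ * K / (Real.pi ^ 2 * B) * ((r : ℝ) ^ 3 * ∑ n ∈ c.support, -((c n).re * x n ^ 2)) := by
          ring
      _ ≤ 2 * c₀ * K / (Real.pi ^ 2 * B) * (B * T) := mul_le_mul_of_nonneg_left hA' hcoef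
      _ = c₀ * K * (2 / Real.pi ^ 2 * T) := by field_simp
      _ ≤ c₀ * K * S := mul_le_mul_of_nonneg_left hJ (mul_nonneg hc₀ hK)
      _ = K * (c₀ * S) := by ring
      _ ≤ K * (genF c φ).re := mul_le_mul_of_nonneg_left (hC φ) hK
  linarith

end Summit.HubbardSuperconductivity.HubbardSuperconductivity.Theorems.FatGaussian
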